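import Summits.QuantumAdvantage.QuantumAdvantage.Theorems.CubicForrelationNearExactIsExactCubicFormR4ZLeafEval

/-!
# Crux `CubicForrelation.NearExactIsExact` (stmt-QuantumAdvantage-14043) — E1280-even, R4 branch, the d-level leaf of descendant `0`:
  the INVERSE FRAME and a PIGEONHOLE

Certificate seat `b2b-cforr-cert` (gen 43).  HONEST FRAMING: kernel-checked bookkeeping (standard axioms, Mathlib + …CubicFormR4ZLeafEval's
block splitting), tool 6 for the leaf statement `HLEAF` of …CubicFormR4ZReduce.  `tq5_frame_inv`: the block frame `P` (columns `y`,
`β_i y + b_i`, `ε_s y + r_s`) has the explicit left inverse `Pinv` (rows `(1; βBi; εRi)`, `(0; Bi_i; 0)`, `(0; 0; Ri_j)`), entrywise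
`Σ_ψ Pi_φ'ψ P_ψφ = [φ' = φ]` — the input of `tps_pair_covariant`.  `tq5_kernel_pigeon`: seven homogeneous linear conditions on eight
unknowns `(w, μ) ∈ 𝔽₂⁷ × 𝔽₂` have a non-zero solution (cardinality pigeonhole) — the kernel vector of the case `rank Ξ ≤ 2`.  Nothing about
`θ₁₂`; NOT summit progress.

References: folklore.  Axioms: the standard three.
-/

set_option linter.dupNamespace false -- D-0017: single-problem summit ⇒ `QuantumAdvantage.QuantumAdvantage` by design

namespace Summit.QuantumAdvantage.QuantumAdvantage.Theorems.CubicForrelation.NearExactIsExact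

open Finset

/-- `κ a ≠ σ j` on `Fin (5 + 7)`. [trivial] -/
theorem tq5_kz_ne (a₁ : Fin 5) (j : Fin 7) : (Fin.castAdd 7 a₁ : Fin (5 + 7)) ≠ Fin.natAdd 5 j :=
  fun h => by have := congrArg Fin.val h; simp at this; omega

/-- `σ j ≠ κ a` on `Fin (5 + 7)`. [trivial] -/
theorem tq5_zk_ne (a₁ : Fin 5) (j : Fin 7) : (Fin.natAdd 5 j : Fin (5 + 7)) ≠ Fin.castAdd 7 a₁ :=
  fun h => tq5_kz_ne a₁ j h.symm

/-- `σ` is injective. [trivial] -/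
theorem tq5_zz_inj (j j' : Fin 7) (h : (Fin.natAdd 5 j : Fin (5 + 7)) = Fin.natAdd 5 j') : j = j' :=
  Fin.ext (by have := congrArg Fin.val h; simp only [Fin.val_natAdd] at this; omega)

/-- `κ0 ≠ κ(i+1)`. [trivial] -/
theorem tq5_ne_0v (i : Fin 4) : (Fin.castAdd 7 (0 : Fin 5) : Fin (5 + 7)) ≠ Fin.castAdd 7 (Fin.succ i) :=
  fun h => Fin.succ_ne_zero i (Fin.castAdd_inj.mp h).symm

/-- `κ(i+1) ≠ κ0`. [trivial] -/
theorem tq5_ne_v0 (i : Fin 4) : (Fin.castAdd 7 (Fin.succ i) : Fin (5 + 7)) ≠ Fin.castAdd 7 (0 : Fin 5) :=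
  fun h => Fin.succ_ne_zero i (Fin.castAdd_inj.mp h)

/-- `κ ∘ succ` is injective. [trivial] -/
theorem tq5_vv_inj (i i' : Fin 4) (h : (Fin.castAdd 7 (Fin.succ i) : Fin (5 + 7)) = Fin.castAdd 7 (Fin.succ i')) : i = i' :=
  Fin.succ_inj.mp (Fin.castAdd_inj.mp h)

/-- **The inverse frame.**  See the module docstring. [this work] -/
theorem tq5_frame_inv (BC Bi : Fin 4 → Fin 4 → ZMod 2) (RC Ri : Fin 7 → Fin 7 → ZMod 2) (β : Fin 4 → ZMod 2) (ε : Fin 7 → ZMod 2)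
    (P Pinv : Fin (5 + 7) → Fin (5 + 7) → ZMod 2)
    (hP0 : ∀ ψ, P ψ (Fin.castAdd 7 (0 : Fin 5)) = (Fin.append (Fin.cons (1) ((0 : Fin 4 → ZMod 2)) : Fin 5 → ZMod 2) ((0 : Fin 7 → ZMod 2)) : Fin (5 + 7) → ZMod 2) ψ)
    (hPv : ∀ ψ (i : Fin 4), P ψ (Fin.castAdd 7 (Fin.succ i)) = (Fin.append (Fin.cons (β i) (BC i) : Fin 5 → ZMod 2) ((0 : Fin 7 → ZMod 2)) : Fin (5 + 7) → ZMod 2) ψ)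
    (hPz : ∀ ψ (j : Fin 7), P ψ (Fin.natAdd 5 j) = (Fin.append (Fin.cons (ε j) ((0 : Fin 4 → ZMod 2)) : Fin 5 → ZMod 2) (RC j) : Fin (5 + 7) → ZMod 2) ψ)
    (hPi0 : ∀ ψ, Pinv (Fin.castAdd 7 (0 : Fin 5)) ψ =
      (Fin.append (Fin.cons (1) ((fun t => ∑ i : Fin 4, β i * Bi i t)) : Fin 5 → ZMod 2) ((fun k => ∑ j : Fin 7, ε j * Ri j k)) : Fin (5 + 7) → ZMod 2) ψ)
    (hPiv : ∀ (i : Fin 4) ψ, Pinv (Fin.castAdd 7 (Fin.succ i)) ψ = (Fin.append (Fin.cons (0) (Bi i) : Fin 5 → ZMod 2) ((0 : Fin 7 → ZMod 2)) : Fin (5 + 7) → ZMod 2) ψ)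
    (hPiz : ∀ (j : Fin 7) ψ, Pinv (Fin.natAdd 5 j) ψ = (Fin.append (Fin.cons (0) ((0 : Fin 4 → ZMod 2)) : Fin 5 → ZMod 2) (Ri j) : Fin (5 + 7) → ZMod 2) ψ)
    (hBiB : ∀ i i' : Fin 4, (∑ t : Fin 4, Bi i t * BC i' t) = if i = i' then 1 else 0)
    (hRiR : ∀ j j' : Fin 7, (∑ k : Fin 7, Ri j k * RC j' k) = if j = j' then 1 else 0) :
    ∀ φ' φ : Fin (5 + 7), (∑ ψ, Pinv φ' ψ * P ψ φ) = if φ' = φ then 1 else 0 := by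
  have hβsum : ∀ i' : Fin 4, (∑ t : Fin 4, (∑ i : Fin 4, β i * Bi i t) * BC i' t) = β i' := by
    intro i'
    calc (∑ t : Fin 4, (∑ i : Fin 4, β i * Bi i t) * BC i' t) = ∑ t : Fin 4, ∑ i : Fin 4, β i * Bi i t * BC i' t := by
          refine sum_congr rfl fun t _ => ?_
          rw [Finset.sum_mul]
      _ = ∑ i : Fin 4, ∑ t : Fin 4, β i * Bi i t * BC i' t := Finset.sum_comm
      _ = ∑ i : Fin 4, β i * ∑ t : Fin 4, Bi i t * BC i' t := by
          refine sum_congr rfl fun i _ => ?_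
          rw [Finset.mul_sum]
          exact sum_congr rfl fun t _ => by ring
      _ = β i' := by
          simp only [hBiB, mul_ite, mul_one, mul_zero, Finset.sum_ite_eq', Finset.mem_univ, if_true]
  have hεsum : ∀ j' : Fin 7, (∑ k : Fin 7, (∑ j : Fin 7, ε j * Ri j k) * RC j' k) = ε j' := by
    intro j'
    calc (∑ k : Fin 7, (∑ j : Fin 7, ε j * Ri j k) * RC j' k) = ∑ k : Fin 7, ∑ j : Fin 7, ε j * Ri j k * RC j' k := by
          refine sum_congr rfl fun k _ => ?_
          rw [Finset.sum_mul]
      _ = ∑ j : Fin 7, ∑ k : Fin 7, ε j * Ri j k * RC j' k := Finset.sum_comm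
      _ = ∑ j : Fin 7, ε j * ∑ k : Fin 7, Ri j k * RC j' k := by
          refine sum_congr rfl fun j _ => ?_
          rw [Finset.mul_sum]
          exact sum_congr rfl fun k _ => by ring
      _ = ε j' := by
          simp only [hRiR, mul_ite, mul_one, mul_zero, Finset.sum_ite_eq', Finset.mem_univ, if_true]
  intro φ' φ
  induction φ' using Fin.addCases with
  | left a' =>
    induction a' using Fin.cases with
    | zero =>
      induction φ using Fin.addCases with
      | left b' =>
        induction b' using Fin.cases with
        | zero =>
          rw [if_pos rfl]
          simp only [hP0, hPi0, tq5_split, Fin.append_left, Fin.append_right, Fin.cons_zero, Fin.cons_succ, Pi.zero_apply, mul_zero, sum_const_zero, add_zero, mul_one]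
        | succ i' =>
          rw [if_neg (tq5_ne_0v i')]
          simp only [hPv, hPi0, tq5_split, Fin.append_left, Fin.append_right, Fin.cons_zero, Fin.cons_succ, Pi.zero_apply, mul_zero, sum_const_zero, add_zero, one_mul]
          rw [hβsum]
          exact CharTwo.add_self_eq_zero _
      | right j' =>
        rw [if_neg (tq5_kz_ne 0 j')]
        simp only [hPz, hPi0, tq5_split, Fin.append_left, Fin.append_right, Fin.cons_zero, Fin.cons_succ, Pi.zero_apply, mul_zero, sum_const_zero, add_zero, one_mul]
        rw [hεsum]
        exact CharTwo.add_self_eq_zero _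
    | succ i =>
      induction φ using Fin.addCases with
      | left b' =>
        induction b' using Fin.cases with
        | zero =>
          rw [if_neg (tq5_ne_v0 i)]
          simp only [hP0, hPiv, tq5_split, Fin.append_left, Fin.append_right, Fin.cons_zero, Fin.cons_succ, Pi.zero_apply, mul_zero, sum_const_zero, add_zero, mul_one]
        | succ i' =>
          by_cases hii : i = i'
          · subst hii
            rw [if_pos rfl]
            simp only [hPv, hPiv, tq5_split, Fin.append_left, Fin.append_right, Fin.cons_zero, Fin.cons_succ, Pi.zero_apply, mul_zero, zero_mul, sum_const_zero, add_zero, zero_add]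
            rw [hBiB, if_pos rfl]
          · rw [if_neg fun h => hii (tq5_vv_inj i i' h)]
            simp only [hPv, hPiv, tq5_split, Fin.append_left, Fin.append_right, Fin.cons_zero, Fin.cons_succ, Pi.zero_apply, mul_zero, zero_mul, sum_const_zero, add_zero, zero_add]
            rw [hBiB, if_neg hii]
      | right j' =>
        rw [if_neg (tq5_kz_ne _ j')]
        simp only [hPz, hPiv, tq5_split, Fin.append_left, Fin.append_right, Fin.cons_zero, Fin.cons_succ, Pi.zero_apply, mul_zero, zero_mul, sum_const_zero, add_zero]
  | right j =>
    induction φ using Fin.addCases with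
    | left b' =>
      rw [if_neg (tq5_zk_ne b' j)]
      induction b' using Fin.cases with
      | zero =>
        simp only [hP0, hPiz, tq5_split, Fin.append_left, Fin.append_right, Fin.cons_zero, Fin.cons_succ, Pi.zero_apply, mul_zero, sum_const_zero, add_zero, mul_one]
      | succ i' =>
        simp only [hPv, hPiz, tq5_split, Fin.append_left, Fin.append_right, Fin.cons_zero, Fin.cons_succ, Pi.zero_apply, mul_zero, zero_mul, sum_const_zero, add_zero]
    | right j' =>
      by_cases hjj : j = j'
      · subst hjj
        rw [if_pos rfl]
        simp only [hPz, hPiz, tq5_split, Fin.append_left, Fin.append_right, Fin.cons_zero, Fin.cons_succ, Pi.zero_apply, mul_zero, zero_mul, sum_const_zero, add_zero, zero_add]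
        rw [hRiR, if_pos rfl]
      · rw [if_neg fun h => hjj (tq5_zz_inj j j' h)]
        simp only [hPz, hPiz, tq5_split, Fin.append_left, Fin.append_right, Fin.cons_zero, Fin.cons_succ, Pi.zero_apply, mul_zero, zero_mul, sum_const_zero, add_zero, zero_add]
        rw [hRiR, if_neg hjj]

/-- **Pigeonhole for the kernel vector**: the conditions `M_t · w = a_t μ` (`t < 4`), `E · w = 0`, `w_s = 0` (`s < k ≤ 2`) on
`(w, μ) ∈ 𝔽₂⁷ × 𝔽₂` have a non-zero solution. [folklore] -/
theorem tq5_kernel_pigeon (MR : Fin 4 → Fin 7 → ZMod 2) (a : Fin 4 → ZMod 2) (ER : Fin 7 → ZMod 2) (k : ℕ) (hk : k ≤ 2) :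
    ∃ (w : Fin 7 → ZMod 2) (μ : ZMod 2), (w ≠ 0 ∨ μ ≠ 0) ∧ (∀ t, (∑ s, MR t s * w s) = a t * μ) ∧ (∑ s, ER s * w s) = 0 ∧
      (∀ s : Fin 7, s.val < k → w s = 0) := by
  classical
  let f : (Fin 7 → ZMod 2) × ZMod 2 → (Fin 4 → ZMod 2) × ZMod 2 × (Fin 2 → ZMod 2) := fun p =>
    (fun t => (∑ s, MR t s * p.1 s) - a t * p.2, ∑ s, ER s * p.1 s,
      fun i => if i.val < k then p.1 (Fin.castLE (by norm_num) i) else 0)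
  have hcard : Fintype.card ((Fin 4 → ZMod 2) × ZMod 2 × (Fin 2 → ZMod 2)) < Fintype.card ((Fin 7 → ZMod 2) × ZMod 2) := by
    simp only [Fintype.card_prod, Fintype.card_fun, ZMod.card, Fintype.card_fin]; norm_num
  obtain ⟨p, q, hne, hpq⟩ := Fintype.exists_ne_map_eq_of_card_lt f hcard
  refine ⟨p.1 - q.1, p.2 - q.2, ?_, fun t => ?_, ?_, fun s hs => ?_⟩
  · by_contra hcon
    rw [not_or, not_ne_iff, not_ne_iff] at hcon
    exact hne (Prod.ext (sub_eq_zero.mp hcon.1) (sub_eq_zero.mp hcon.2))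
  · have e := congrArg (fun x => x.1 t) hpq
    simp only [f] at e
    simp only [Pi.sub_apply, mul_sub, Finset.sum_sub_distrib]
    linear_combination e
  · have e := congrArg (fun x => x.2.1) hpq
    simp only [f] at e
    simp only [Pi.sub_apply, mul_sub, Finset.sum_sub_distrib]
    linear_combination e
  · have e := congrArg (fun x => x.2.2 ⟨s.val, by omega⟩) hpq
    have hsk : (⟨s.val, by omega⟩ : Fin 2).val < k := hs
    simp only [f, if_pos hsk] at e
    have hc : (Fin.castLE (by norm_num) (⟨s.val, by omega⟩ : Fin 2) : Fin 7) = s := Fin.ext rfl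
    rw [hc] at e
    rw [Pi.sub_apply, e, sub_self]

end Summit.QuantumAdvantage.QuantumAdvantage.Theorems.CubicForrelation.NearExactIsExact
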